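import Summits.QuantumFields.QCD.Theses.EulerDescent
import Summits.QuantumFields.QCD.Theorems.EulerDescentHonestHeavyAnchorSplit
import Summits.QuantumFields.QCD.Theorems.RobustYangMillsHandover.Negative.ChiralityObstruction
import Summits.QuantumFields.QCD.Theorems.RayDescent.Negative.TrivialSlices

/-!
# Disproof of `ChiralCornerSoftness` (stmt-QuantumFields-16902) — findings of the crux disprover, cycle 1

Crux (route `EulerDescent`, rank 4):
`∀ N_f ∈ {2,3}, ∀ reg mc, Corner reg mc → Pin reg mc → reg.HasMassScaling → AS reg → Branch reg → reg.IsChiralAtZero`.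

## Findings (all kernel-checked below unless marked NEAR-MISS)

* **No unconditional kill is possible in the present tree** (confirms ATTACK-r1 §2 and STRATEGY-CENSUS §Negation,
  re-derived independently): `not_chiralCornerSoftness_iff` — `¬ crux` is LITERALLY the existence of an honestly
  pinned `N_f ∈ {2,3}` regularisation with ONE lattice rate at ALL positive tuples (a "hard Wilson corner").  Both the
  hypotheses (the corner is the least upper bound of the honest non-massive set of lattice QCD at `β_k → ∞`) and the
  negated conclusion (a mass-uniform lattice gap of light-quark lattice QCD) are statements about
  `qcdLatticeConnectedCorr`, a concrete Grassmann/Haar object with no evaluation theorem in the tree; the junk escapes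
  (Z = 0 ⇒ correlators 0; small tori; unit relabelings; `N_f` guard) are closed — see §3.
* **Load-bearing analysis, modulo named lattice-gap hypotheses** (§2; each `H` is a precise `Prop` about honest lattice
  QCD that the tree cannot construct, and each witness is an explicit structure update of the regularisation in `H`):
  - `withoutPin_false_of_gappedAnchor`: drop the PIN ⇒ false, witness = the `m_crit`-shift
    `m_crit ↦ m_crit + a M_h/Z_m` of any corner-carrying, scaling regularisation uniformly gapped above `M_h`
    (H = `HonestHeavyAnchor`'s lattice clause with a uniform rate).  "Any proof must use the pin."
  - `withoutCorner_false_of_gappedScalingReg`: drop the CORNER (keep a pin to an arbitrary `mc`) ⇒ false, same witness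
    with `mc := m_crit'` (pin ≡ 0).  "The pin is only as good as the set it pins to."
  - `withoutMassScaling_false_of_tupleUniformGap`: drop `HasMassScaling` ⇒ false, witness = `Z_m ↦ Z_m/(k+1)` of an
    honestly pinned regularisation whose heavy region is gapped uniformly in the (k-dependent) tuple: the pin survives
    (it is multiplied by `1/(k+1)`), every positive tuple is driven to renormalised mass `m (k+1) → ∞`.
  - `withoutAsymptoticScaling_false_of_hardConstantCouplingCorner`: drop AS ⇒ false, witness = a constant-coupling
    regularisation parked exactly at its own corner `μ_c(β*)` (pin ≡ 0), which is hard in units of `a_k`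
    (both Sharpe–Singleton scenarios: lattice pion mass `≍ √(a m/Z_m)` or bounded below ⇒ physical rate → ∞).
  - `branch_of_corner_pin_massScaling` / `chiralCornerSoftness_iff_withoutBranch`: the branch hypothesis
    `∀ᶠ k, −1 < m_crit k` is REDUNDANT modulo "the weak-coupling Wilson corner stays above `−1 + η`"
    (physically `μ_c(β) → 0⁻`): corner + pin + mass scaling give `m_crit − mc → 0` (uses the landed
    `HonestHeavyAnchorSplit.tendsto_a_div_Zm`).  Information for the prover: h₅'s only role is Lüscher positivity.
  - `N_f` guard: at `N_f = 0` the corner clause is unsatisfiable (landed `RayDescentNegative.corner_unsat_zero`), so the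
    guard is idle there; it is load-bearing exactly at `N_f = 1` (no Goldstone boson; η′ massive) — a tautological
    witness, not written out.
* **Line `Sketch` (twisted-ray Goldstone reductio; stubs E1 `stub_slabFluxBound`, E5 `stub_twistStability`,
  E2+E4 `stub_twistedPPCeiling`, E3 `stub_condensateFluxFloor`)** — §4:
  - composition re-checked on the farm (rc 0, sorries = the 4 stubs); joint sufficiency is kernel-checked by the lead.
  - E1 convention audit PASSES: `conservedVectorCurrent T μ` sits on the link `(0, μ)` with BACKWARD divergence
    conserved (QCDCurrentSector docstring, conventions checked against `wilsonDirac`), so Gauss over the slab complement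
    `s₀ ≤ y₀ ≤ N − s₀` leaves exactly the two layers `V₀(N−s₀ ≡ −s₀)` and `V₀(s₀−1)` that `Φ` uses; `[τ², τ³] = 2iτ¹`
    gives `K = 2`; at `μl = 0` both sides vanish (flavour parity `ψ ↦ iτ²ψ`: `τ¹ ↦ −τ¹`, `τ² ↦ τ²`), so the `μl = 0`
    slice has no teeth.  A one-layer slice offset WOULD be fatal (no universal `K`: `C(s₀−1)/Σ_slab C → ∞` in the
    hopping regime) — worth a unit test by the E1 worker at `β = 0`, leading order in `κ`.
  - E3 tightness (`floor_not_uniform_in_t`, abstract form): the quantifier order `∀ t ∈ (0,t₀], ∀ᶠ k` of E3 is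
    essential — a floor with a `t`-UNIFORM threshold contradicts `Φ_{k,S}(t) → Φ_{k,S}(0) = 0` (`t → 0⁺` at fixed
    `k, S`: finite-volume continuity at the untwisted critical point, `Z_{k,S}(0) > 0` for `N_f = 2` by `det² ≥ 0`).
    Do not reshape E3 to a uniform threshold.
  - E2+E4 is undersold as "RP/transfer-matrix regularity": the bound `C(s) ≤ c̄ a³ Z_m² e^{−(ε/2)(as−τ)}` with `c̄`
    uniform in `k` is UV FINITENESS of the renormalised zero-momentum `P¹P¹` correlator at physical time `τ` along an
    AF trajectory (`Z_P⁻² ≍ Z_m²` to leading log) — an a-priori bound of continuum-limit grade; its `t`-uniformity under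
    `TwGap(ε/2)` is physically right (`G_π²/2M_π ≤ f²B²/ε`).  Non-vacuous in the real world at `t = 1`, `ε` small.
  - E5 presupposes twisted/untwisted universality at finite `a` (Symanzik-grade), inside the reductio; not attackable.
  - E3 for `N_f = 2` is STRICTLY STRONGER than the crux needs (a chirally symmetric massless-nucleon phase would make
    E3 false and the crux true); for `N_f = 3` it is the Kogan–Kovner–Shifman reading of anomaly matching.
* NEAR-MISS (not attempted in Lean, recorded for the next cycle): `Φ_{k,S}(t = 0) = 0` by flavour parity in the
  tree's Grassmann algebra (needs a Berezin change of variables for the `SU(2)` flavour rotation `iτ²` and the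
  invariance of `diracMatrix`); with it `floor_not_uniform_in_t` becomes a statement about the actual `Φ`.

Everything in §1–§3 is pure logic / real analysis over `QCDOS.lean`; nothing asserts a Theses decl positively.
-/

noncomputable section

namespace Summit.QuantumFields.QCD.Cruxes.ChiralCornerSoftness.Disproof

open Filter Topology
open Literature.MathematicalPhysics.QuantumFieldTheory
open Summit.QuantumFields.QCD.Theses.EulerDescent (ChiralCornerSoftness)
open Summit.QuantumFields.QCD.Theorems

variable {Nf : ℕ}

/-! ## §1 Vocabulary (workfile-local; the landed `Negative/LoadBearing.lean` inlines all of it) -/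

/-- The crux's corner clause: eventually `mc k` is the least upper bound of the non-massive degenerate bare masses at
`β_k` (verbatim). [folklore] -/
def Corner (reg : QCDRegularisation Nf) (mc : ℕ → ℝ) : Prop :=
  ∀ᶠ k in atTop, IsLUB {μ : ℝ | ¬ (∀ (R R' : ℕ) (A : QCDLatticeObservable Nf R) (B : QCDLatticeObservable Nf R'),
    ∃ (C δ : ℝ) (S₀ : ℕ), 0 < δ ∧ ∀ S : ℕ, S₀ ≤ S → ∀ n : ℕ, n ≤ S →
      ‖qcdLatticeConnectedCorr (reg.β k) (2 * S + 1) (fun _ : Fin Nf => μ) A B n‖ ≤ C * Real.exp (-(δ * n)))} (mc k)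

/-- The pin `(m_crit − mc)·Z_m/a → 0` (verbatim). [folklore] -/
def Pin (reg : QCDRegularisation Nf) (mc : ℕ → ℝ) : Prop :=
  Tendsto (fun k => (reg.mcrit k - mc k) * reg.Zm k / reg.a k) atTop (nhds 0)

/-- Two-loop asymptotic scaling of the regularisation (verbatim: read through the zero-mass scheme). [folklore] -/
def AS (reg : QCDRegularisation Nf) : Prop := (reg.scheme 0 0 0).HasAsymptoticScaling

/-- The physical branch `m_crit > −1` eventually (verbatim). [folklore] -/
def Branch (reg : QCDRegularisation Nf) : Prop := ∀ᶠ k in atTop, (-1 : ℝ) < reg.mcrit k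

/-- ONE lattice rate `ε` at ALL positive tuples (the negation of `IsChiralAtZero` at the rate `ε`). [folklore] -/
def UniformGap (reg : QCDRegularisation Nf) (ε : ℝ) : Prop :=
  ∀ m : Fin Nf → ℝ, (∀ f, 0 < m f) → (reg.scheme m 0 0).HasLatticeMassGap ε

/-- The crux restated over the vocabulary (definitionally the route decl, `crux_iff`). [folklore] -/
def Crux : Prop :=
  ∀ Nf : ℕ, Nf = 2 ∨ Nf = 3 → ∀ (reg : QCDRegularisation Nf) (mc : ℕ → ℝ),
    Corner reg mc → Pin reg mc → reg.HasMassScaling → AS reg → Branch reg → reg.IsChiralAtZero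

/-- `Crux` is the route decl, definitionally. [folklore] -/
theorem crux_iff : Crux ↔ ChiralCornerSoftness := Iff.rfl

/-! ## §2 Load-bearing analysis (each mutilated crux is false modulo a named lattice-gap hypothesis) -/

/-- ¬crux in canonical form: an honestly pinned regularisation with ONE rate at ALL positive tuples. [folklore] -/
theorem not_crux_iff :
    ¬ Crux ↔ ∃ Nf : ℕ, (Nf = 2 ∨ Nf = 3) ∧ ∃ (reg : QCDRegularisation Nf) (mc : ℕ → ℝ),
      Corner reg mc ∧ Pin reg mc ∧ reg.HasMassScaling ∧ AS reg ∧ Branch reg ∧ ∃ ε > (0 : ℝ), UniformGap reg ε := by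
  constructor
  · intro h
    by_contra hne
    apply h
    intro Nf hNf reg mc hc hp hms has hbr
    by_contra hchi
    obtain ⟨ε, hε, hgap⟩ :=
      (RobustYangMillsHandover.Negative.not_isChiralAtZero_iff_uniformLatticeGap reg).mp hchi
    exact hne ⟨Nf, hNf, reg, mc, hc, hp, hms, has, hbr, ε, hε, hgap⟩
  · rintro ⟨Nf, hNf, reg, mc, hc, hp, hms, has, hbr, ε, hε, hgap⟩ h
    exact RobustYangMillsHandover.Negative.not_isChiralAtZero_of_uniformLatticeGap reg hε hgap
      (h Nf hNf reg mc hc hp hms has hbr)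

/-- The same for the route decl by name. [folklore] -/
theorem not_chiralCornerSoftness_iff :
    ¬ ChiralCornerSoftness ↔ ∃ Nf : ℕ, (Nf = 2 ∨ Nf = 3) ∧ ∃ (reg : QCDRegularisation Nf) (mc : ℕ → ℝ),
      Corner reg mc ∧ Pin reg mc ∧ reg.HasMassScaling ∧ AS reg ∧ Branch reg ∧ ∃ ε > (0 : ℝ), UniformGap reg ε :=
  not_crux_iff

/-! ### The PIN is load-bearing -/

/-- The crux with the PIN dropped. [folklore] -/
def WithoutPin : Prop :=
  ∀ Nf : ℕ, Nf = 2 ∨ Nf = 3 → ∀ (reg : QCDRegularisation Nf) (mc : ℕ → ℝ),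
    Corner reg mc → reg.HasMassScaling → AS reg → Branch reg → reg.IsChiralAtZero

/-- **H_anchor** (`HonestHeavyAnchor`'s lattice clause with ONE rate): a corner-carrying, mass-scaling, asymptotically
scaling regularisation on the physical branch that is uniformly gapped at every tuple above a threshold `M_h`.
Physically: the lightest state above the threshold is a glueball or a heavy meson, both `≥ ε`.  Not constructible in
the tree (it contains a lattice mass gap of QCD with heavy quarks along an AF sequence). [folklore] -/
def GappedAnchor (Nf : ℕ) : Prop :=
  ∃ (reg : QCDRegularisation Nf) (mc : ℕ → ℝ), Corner reg mc ∧ reg.HasMassScaling ∧ AS reg ∧ Branch reg ∧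
    ∃ Mh : ℝ, 0 ≤ Mh ∧ ∃ ε > (0 : ℝ), ∀ m : Fin Nf → ℝ, (∀ f, Mh < m f) → (reg.scheme m 0 0).HasLatticeMassGap ε

/-- **Dropping the PIN is fatal (modulo H_anchor)**: the `m_crit`-shifted regularisation
`m_crit ↦ m_crit + a M_h/Z_m` keeps the corner (same `β`), mass scaling (same `Z_m`), asymptotic scaling (same
`β, a`) and the branch (`m_crit` only grows), and is NOT chiral at zero (landed
`RobustYangMillsHandover.Negative.not_isChiralAtZero_mcrit_shift_of_uniformGapAbove`).  Any proof of the crux must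
use the pin. [folklore] -/
theorem withoutPin_false_of_gappedAnchor (H : ∃ Nf : ℕ, (Nf = 2 ∨ Nf = 3) ∧ GappedAnchor Nf) : ¬ WithoutPin := by
  obtain ⟨Nf, hNf, reg, mc, hc, hms, has, hbr, Mh, hMh, ε, hε, hgap⟩ := H
  intro h
  have hchi := h Nf hNf ({ reg with mcrit := fun k => reg.mcrit k + reg.a k * Mh / reg.Zm k } :
      QCDRegularisation Nf) mc hc hms has (by
    filter_upwards [hbr] with k hk
    have : 0 ≤ reg.a k * Mh / reg.Zm k := div_nonneg (mul_nonneg (reg.a_pos k).le hMh) (reg.Zm_pos k).le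
    show (-1 : ℝ) < reg.mcrit k + reg.a k * Mh / reg.Zm k
    linarith)
  exact RobustYangMillsHandover.Negative.not_isChiralAtZero_mcrit_shift_of_uniformGapAbove reg Mh hε hgap hchi

/-! ### The CORNER is load-bearing -/

/-- The crux with the CORNER dropped (a pin to an arbitrary sequence `mc`). [folklore] -/
def WithoutCorner : Prop :=
  ∀ Nf : ℕ, Nf = 2 ∨ Nf = 3 → ∀ (reg : QCDRegularisation Nf) (mc : ℕ → ℝ),
    Pin reg mc → reg.HasMassScaling → AS reg → Branch reg → reg.IsChiralAtZero

/-- **H_reg** (weaker than H_anchor: no corner needed): a mass-scaling, asymptotically scaling regularisation on the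
physical branch, uniformly gapped above a threshold. [folklore] -/
def GappedScalingReg (Nf : ℕ) : Prop :=
  ∃ reg : QCDRegularisation Nf, reg.HasMassScaling ∧ AS reg ∧ Branch reg ∧
    ∃ Mh : ℝ, 0 ≤ Mh ∧ ∃ ε > (0 : ℝ), ∀ m : Fin Nf → ℝ, (∀ f, Mh < m f) → (reg.scheme m 0 0).HasLatticeMassGap ε

/-- H_anchor gives H_reg. [folklore] -/
theorem gappedScalingReg_of_gappedAnchor (h : GappedAnchor Nf) : GappedScalingReg Nf := by
  obtain ⟨reg, -, -, hms, has, hbr, rest⟩ := h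
  exact ⟨reg, hms, has, hbr, rest⟩

/-- **Dropping the CORNER is fatal (modulo H_reg)**: pin the shifted regularisation to ITS OWN critical mass
(`mc := m_crit'`, pin ≡ 0). The pin is only as good as the set it pins to. [folklore] -/
theorem withoutCorner_false_of_gappedScalingReg (H : ∃ Nf : ℕ, (Nf = 2 ∨ Nf = 3) ∧ GappedScalingReg Nf) :
    ¬ WithoutCorner := by
  obtain ⟨Nf, hNf, reg, hms, has, hbr, Mh, hMh, ε, hε, hgap⟩ := H
  intro h
  set reg' : QCDRegularisation Nf := { reg with mcrit := fun k => reg.mcrit k + reg.a k * Mh / reg.Zm k } with hreg'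
  have hpin : Pin reg' reg'.mcrit := by
    simp only [Pin, sub_self, zero_mul, zero_div]
    exact tendsto_const_nhds
  have hchi := h Nf hNf reg' reg'.mcrit hpin hms has (by
    filter_upwards [hbr] with k hk
    have : 0 ≤ reg.a k * Mh / reg.Zm k := div_nonneg (mul_nonneg (reg.a_pos k).le hMh) (reg.Zm_pos k).le
    show (-1 : ℝ) < reg.mcrit k + reg.a k * Mh / reg.Zm k
    linarith)
  exact RobustYangMillsHandover.Negative.not_isChiralAtZero_mcrit_shift_of_uniformGapAbove reg Mh hε hgap hchi

/-! ### MASS SCALING is load-bearing -/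

/-- The crux with `HasMassScaling` dropped. [folklore] -/
def WithoutMassScaling : Prop :=
  ∀ Nf : ℕ, Nf = 2 ∨ Nf = 3 → ∀ (reg : QCDRegularisation Nf) (mc : ℕ → ℝ),
    Corner reg mc → Pin reg mc → AS reg → Branch reg → reg.IsChiralAtZero

/-- **H_tuple**: an HONESTLY PINNED regularisation (all five crux hypotheses) whose heavy region `μ_f ≥ M_h` is gapped
at ONE rate with constants uniform in the (possibly `k`-dependent) renormalised tuple `μ` — the bare-parameter form of
"heavier is more gapped, amplitudes bounded".  Not constructible in the tree. [folklore] -/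
def TupleUniformGap (Nf : ℕ) : Prop :=
  ∃ (reg : QCDRegularisation Nf) (mc : ℕ → ℝ), Corner reg mc ∧ Pin reg mc ∧ reg.HasMassScaling ∧ AS reg ∧
    Branch reg ∧ ∃ Mh ε : ℝ, 0 < ε ∧
      ∀ (R R' : ℕ) (A : QCDLatticeObservable Nf R) (B : QCDLatticeObservable Nf R'), ∃ C : ℝ, ∀ᶠ k in atTop,
        ∀ μ : Fin Nf → ℝ, (∀ f, Mh ≤ μ f) → ∀ S : ℕ, reg.L k ≤ S → ∀ n : ℕ, n ≤ S →
          ‖qcdLatticeConnectedCorr (reg.β k) (2 * S + 1) (fun f => reg.mcrit k + reg.a k * μ f / reg.Zm k) A B n‖ ≤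
            C * Real.exp (-(ε * (reg.a k * n)))

/-- **Dropping `HasMassScaling` is fatal (modulo H_tuple)**: divide `Z_m` by `k + 1`.  The corner (same `β`), the
branch (same `m_crit`) and asymptotic scaling (same `β, a`) are untouched; the pin is MULTIPLIED by `1/(k+1)` and
survives; but the positive tuple `m` is now realised by the bare masses of the renormalised tuple `(k+1)·m → ∞`, which
is eventually heavy, so every positive tuple carries the rate `ε`: not chiral at zero.  (The witness violates mass
scaling, as it must if the crux is true: `Z_m/(k+1)/log^γ → 0`.)  Any proof must use `HasMassScaling` — it is what
keeps `∀ m > 0` an honest light-quark family. [folklore] -/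
theorem withoutMassScaling_false_of_tupleUniformGap (H : ∃ Nf : ℕ, (Nf = 2 ∨ Nf = 3) ∧ TupleUniformGap Nf) :
    ¬ WithoutMassScaling := by
  obtain ⟨Nf, hNf, reg, mc, hc, hp, -, has, hbr, Mh, ε, hε, hgap⟩ := H
  intro h
  set reg' : QCDRegularisation Nf :=
    { reg with Zm := fun k => reg.Zm k / ((k : ℝ) + 1)
               Zm_pos := fun k => div_pos (reg.Zm_pos k) (by positivity) } with hreg'
  -- the pin survives: it is the old pin times `1/(k+1)`
  have hpin : Pin reg' mc := by
    have h1 : Tendsto (fun k : ℕ => 1 / ((k : ℝ) + 1)) atTop (nhds 0) := tendsto_one_div_add_atTop_nhds_zero_nat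
    have h2 := hp.mul h1
    rw [mul_zero] at h2
    refine h2.congr' (Eventually.of_forall fun k => ?_)
    show (reg.mcrit k - mc k) * reg.Zm k / reg.a k * (1 / ((k : ℝ) + 1)) =
      (reg.mcrit k - mc k) * (reg.Zm k / ((k : ℝ) + 1)) / reg.a k
    ring
  have hchi : reg'.IsChiralAtZero := h Nf hNf reg' mc hc hpin has hbr
  -- every positive tuple of `reg'` carries the rate `ε`
  refine RobustYangMillsHandover.Negative.not_isChiralAtZero_of_uniformLatticeGap reg' hε (fun m hm => ?_) hchi
  intro R R' A B
  obtain ⟨C, hC⟩ := hgap R R' A B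
  refine ⟨C, ?_⟩
  have hheavy : ∀ᶠ k : ℕ in atTop, ∀ f : Fin Nf, Mh ≤ ((k : ℝ) + 1) * m f := by
    refine eventually_all.2 fun f => ?_
    have ht : Tendsto (fun k : ℕ => ((k : ℝ) + 1) * m f) atTop atTop :=
      (tendsto_natCast_atTop_atTop.atTop_add tendsto_const_nhds).atTop_mul_const (hm f)
    exact ht.eventually_ge_atTop Mh
  filter_upwards [hC, hheavy] with k hk hh S hS n hn
  have hmq : (fun fl => (reg'.scheme m 0 0).mq fl k) = fun f => reg.mcrit k + reg.a k * (((k : ℝ) + 1) * m f) / reg.Zm k := by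
    funext f
    show reg.mcrit k + reg.a k * m f / (reg.Zm k / ((k : ℝ) + 1)) = _
    have hZ : reg.Zm k ≠ 0 := (reg.Zm_pos k).ne'
    have hk1 : ((k : ℝ) + 1) ≠ 0 := by positivity
    field_simp
  have := hk (fun f => ((k : ℝ) + 1) * m f) hh S hS n hn
  rw [hmq]
  exact this

/-! ### ASYMPTOTIC SCALING is load-bearing -/

/-- The crux with asymptotic scaling dropped. [folklore] -/
def WithoutAsymptoticScaling : Prop :=
  ∀ Nf : ℕ, Nf = 2 ∨ Nf = 3 → ∀ (reg : QCDRegularisation Nf) (mc : ℕ → ℝ),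
    Corner reg mc → Pin reg mc → reg.HasMassScaling → Branch reg → reg.IsChiralAtZero

/-- **H_const**: at some FIXED coupling `β*` the non-massive degenerate bare masses have a least upper bound
`μ* > −1`, and a mass-scaling regularisation with `β_k ≡ β*` parked EXACTLY at `m_crit ≡ μ*` is uniformly gapped in its
own units `a_k → 0` (physically: approaching `κ_c(β*)` from the massive side at bare offset `a_k m/Z_m(k)`, the lattice
correlation length grows at most like `(a_k m/Z_m)^{-1/2}` (Aoki scenario, GMOR at fixed `β`) or stays bounded
(first-order scenario), so the rate in units of `a_k` diverges).  Not constructible in the tree. [folklore] -/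
def HardConstantCouplingCorner (Nf : ℕ) : Prop :=
  ∃ (reg : QCDRegularisation Nf) (β₀ μ₀ : ℝ), (∀ k, reg.β k = β₀) ∧ (∀ k, reg.mcrit k = μ₀) ∧
    IsLUB {μ : ℝ | ¬ (∀ (R R' : ℕ) (A : QCDLatticeObservable Nf R) (B : QCDLatticeObservable Nf R'),
      ∃ (C δ : ℝ) (S₀ : ℕ), 0 < δ ∧ ∀ S : ℕ, S₀ ≤ S → ∀ n : ℕ, n ≤ S →
        ‖qcdLatticeConnectedCorr β₀ (2 * S + 1) (fun _ : Fin Nf => μ) A B n‖ ≤ C * Real.exp (-(δ * n)))} μ₀ ∧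
    (-1 : ℝ) < μ₀ ∧ reg.HasMassScaling ∧ ∃ ε > (0 : ℝ), UniformGap reg ε

/-- **Dropping asymptotic scaling is fatal (modulo H_const)**: the constant-coupling regularisation of H_const carries
the corner (constantly), the pin (≡ 0), mass scaling and the branch, and is not chiral at zero.  Asymptotic scaling
is what makes `a_k` the lattice spacing of the asymptotically free theory rather than a label. [folklore] -/
theorem withoutAsymptoticScaling_false_of_hardConstantCouplingCorner
    (H : ∃ Nf : ℕ, (Nf = 2 ∨ Nf = 3) ∧ HardConstantCouplingCorner Nf) : ¬ WithoutAsymptoticScaling := by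
  obtain ⟨Nf, hNf, reg, β₀, μ₀, hβ, hcrit, hlub, hμ₀, hms, ε, hε, hgap⟩ := H
  intro h
  have hc : Corner reg (fun _ => μ₀) := Eventually.of_forall fun k => by rw [hβ k]; exact hlub
  have hp : Pin reg (fun _ => μ₀) := by
    refine (tendsto_const_nhds (x := (0 : ℝ))).congr' (Eventually.of_forall fun k => ?_)
    simp [hcrit k]
  have hbr : Branch reg := Eventually.of_forall fun k => by rw [hcrit k]; exact hμ₀
  exact RobustYangMillsHandover.Negative.not_isChiralAtZero_of_uniformLatticeGap reg hε hgap
    (h Nf hNf reg _ hc hp hms hbr)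

/-! ### The BRANCH hypothesis is redundant modulo "the corner stays above `−1 + η`" -/

/-- The crux with the branch hypothesis dropped. [folklore] -/
def WithoutBranch : Prop :=
  ∀ Nf : ℕ, Nf = 2 ∨ Nf = 3 → ∀ (reg : QCDRegularisation Nf) (mc : ℕ → ℝ),
    Corner reg mc → Pin reg mc → reg.HasMassScaling → AS reg → reg.IsChiralAtZero

/-- **Corner + pin + mass scaling put `m_crit` within `o(1)` of the corner**: `m_crit k − mc k → 0`
(`= pin_k · a_k/Z_m(k)`, and `a_k/Z_m(k) → 0` for `N_f = 2,3` by the landed `HonestHeavyAnchorSplit.tendsto_a_div_Zm`).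
[folklore] -/
theorem tendsto_mcrit_sub_corner (hNf : Nf = 2 ∨ Nf = 3) (reg : QCDRegularisation Nf) (mc : ℕ → ℝ)
    (hp : Pin reg mc) (hms : reg.HasMassScaling) : Tendsto (fun k => reg.mcrit k - mc k) atTop (nhds 0) := by
  have h1 := HonestHeavyAnchorSplit.tendsto_a_div_Zm reg hms (HonestHeavyAnchorSplit.massExponent_nonneg hNf)
  have h2 := hp.mul h1
  rw [mul_zero] at h2
  refine h2.congr' (Eventually.of_forall fun k => ?_)
  have ha : reg.a k ≠ 0 := (reg.a_pos k).ne'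
  have hZ : reg.Zm k ≠ 0 := (reg.Zm_pos k).ne'
  field_simp

/-- **The branch is implied** by pin + mass scaling once the corner stays eventually above `−1 + η` for some `η > 0`
(for `N_f = 2, 3`). [folklore] -/
theorem branch_of_corner_pin_massScaling (hNf : Nf = 2 ∨ Nf = 3) (reg : QCDRegularisation Nf) (mc : ℕ → ℝ)
    (hp : Pin reg mc) (hms : reg.HasMassScaling) {η : ℝ} (hη : 0 < η) (hmc : ∀ᶠ k in atTop, -1 + η ≤ mc k) :
    Branch reg := by
  have h := tendsto_mcrit_sub_corner hNf reg mc hp hms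
  have hε : ∀ᶠ k in atTop, -(η / 2) < reg.mcrit k - mc k :=
    h.eventually (eventually_gt_nhds (by linarith))
  filter_upwards [hε, hmc] with k h1 h2
  linarith

/-- **H_above**: along every asymptotically scaling regularisation, a corner (if it exists eventually) stays above
`−1 + η` (physically `μ_c(β) → 0⁻` as `β → ∞`; the doublers' critical points sit at `−2, −4, −6, −8`). [folklore] -/
def CornersAboveMinusOne : Prop :=
  ∀ Nf : ℕ, Nf = 2 ∨ Nf = 3 → ∀ (reg : QCDRegularisation Nf) (mc : ℕ → ℝ), Corner reg mc → AS reg →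
    ∃ η > (0 : ℝ), ∀ᶠ k in atTop, -1 + η ≤ mc k

/-- **Modulo H_above the branch hypothesis is decoration**: the crux is equivalent to its branch-free form.
Information for the prover: `∀ᶠ k, −1 < m_crit k` is never needed for TRUTH, only as the Lüscher positivity range
(`κ < 1/6`) in transfer-matrix PROOFS. [folklore] -/
theorem chiralCornerSoftness_iff_withoutBranch (H : CornersAboveMinusOne) : ChiralCornerSoftness ↔ WithoutBranch := by
  rw [← crux_iff]
  constructor
  · intro h Nf hNf reg mc hc hp hms has
    obtain ⟨η, hη, hmc⟩ := H Nf hNf reg mc hc has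
    exact h Nf hNf reg mc hc hp hms has (branch_of_corner_pin_massScaling hNf reg mc hp hms hη hmc)
  · intro h Nf hNf reg mc hc hp hms has _
    exact h Nf hNf reg mc hc hp hms has

/-! ## §3 Closed junk escapes (records; the `N_f = 0` slice is landed as `RayDescentNegative.corner_unsat_zero`) -/

/-- The `N_f = 0` slice of the corner clause is unsatisfiable (so the `N_f ∈ {2,3}` guard is idle there; it bites at
`N_f = 1`). [folklore] -/
theorem corner_zero_unsat (reg : QCDRegularisation 0) (mc : ℕ → ℝ) : ¬ Corner reg mc :=
  RayDescentNegative.not_eventually_corner_zero reg mc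

/-- Unit relabelings open no loophole: `(a, Z_m) ↦ (c a, c Z_m)` fixes every bare trajectory and the pin and maps
`UniformGap reg' ε ↔ UniformGap reg (c ε)` (landed `RayDescentNegative.gap_iff_of_rescaled`), so `∃ ε > 0, UniformGap`
— hence `IsChiralAtZero` — is invariant. [folklore] -/
theorem uniformGap_rescale (reg reg' : QCDRegularisation Nf) {c : ℝ} (hc : 0 < c)
    (ha : ∀ k, reg'.a k = c * reg.a k) (hZ : ∀ k, reg'.Zm k = c * reg.Zm k) (hcrit : ∀ k, reg'.mcrit k = reg.mcrit k)
    (hβ : ∀ k, reg'.β k = reg.β k) (hL : ∀ k, reg'.L k = reg.L k) :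
    (∃ ε > (0 : ℝ), UniformGap reg' ε) ↔ ∃ ε > (0 : ℝ), UniformGap reg ε := by
  constructor
  · rintro ⟨ε, hε, h⟩
    exact ⟨c * ε, by positivity, fun m hm =>
      (RayDescentNegative.gap_iff_of_rescaled reg reg' c ha hZ hcrit hc.ne' hβ hL m ε).mp (h m hm)⟩
  · rintro ⟨ε, hε, h⟩
    refine ⟨ε / c, by positivity, fun m hm => ?_⟩
    rw [RayDescentNegative.gap_iff_of_rescaled reg reg' c ha hZ hcrit hc.ne' hβ hL m (ε / c)]
    rw [mul_div_cancel₀ _ hc.ne']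
    exact h m hm

/-! ## §4 Line `Sketch` — E3 cannot be made uniform in `t` at fixed `k` (abstract tightness) -/

/-- **A flux floor with a `t`-uniform threshold contradicts continuity at the pin.**  Abstract form of the tightness of
E3's quantifier order: if for every `k, S` the flux `t ↦ Φ k S t` tends to `0` as `t → 0⁺` (finite-volume continuity
at the untwisted critical point plus the flavour-parity zero `Φ k S 0 = 0`), then no positive floor
`φ₀ ≤ w k · |Φ k S t|` can hold for all `t ∈ (0, t₀]` at any single `(k, S)` — let alone eventually in `k`.  (E3 as
registered has `∀ t, ∀ᶠ k`, threshold depending on `t`, and is consistent with this.) [folklore] -/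
theorem floor_not_uniform_in_t (Φ : ℕ → ℕ → ℝ → ℝ) (w : ℕ → ℝ)
    (hcont : ∀ k S, Tendsto (fun t => Φ k S t) (nhdsWithin 0 (Set.Ioi 0)) (nhds 0))
    {φ₀ t₀ : ℝ} (hφ₀ : 0 < φ₀) (ht₀ : 0 < t₀) (k S : ℕ)
    (hfloor : ∀ t : ℝ, 0 < t → t ≤ t₀ → φ₀ ≤ w k * |Φ k S t|) : False := by
  -- `w k * |Φ k S t| → 0` along `t → 0⁺`, but it is `≥ φ₀ > 0` on `(0, t₀]`
  have h1 : Tendsto (fun t => w k * |Φ k S t|) (nhdsWithin 0 (Set.Ioi 0)) (nhds 0) := by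
    have := ((hcont k S).abs).const_mul (w k)
    simpa using this
  have h2 : ∀ᶠ t in nhdsWithin (0 : ℝ) (Set.Ioi 0), w k * |Φ k S t| < φ₀ := h1.eventually (eventually_lt_nhds hφ₀)
  have h3 : ∀ᶠ t in nhdsWithin (0 : ℝ) (Set.Ioi 0), 0 < t ∧ t ≤ t₀ := by
    have hIoc : Set.Ioc (0 : ℝ) t₀ ∈ nhdsWithin (0 : ℝ) (Set.Ioi 0) := Ioc_mem_nhdsGT ht₀
    filter_upwards [hIoc] with t ht
    exact ⟨ht.1, ht.2⟩
  obtain ⟨t, hlt, ht0, htt₀⟩ := (h2.and h3).exists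
  linarith [hfloor t ht0 htt₀]

end Summit.QuantumFields.QCD.Cruxes.ChiralCornerSoftness.Disproof

end
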